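import Summits.AnomalousDissipation.AnomalousDissipation.Theorems.SolenoidalFractalHomogenisationLagrangianStepVmodDistortedDefs
import HarnessLib

/-!
# (ℓ3-A) re-typing SKETCH after RULING D28-8′ — `FullBound` (T-a), `IsFrameModulation` (T-b), the re-typed (M_θ)′ `NearMultGF`
(certifier planner ad-ideate-p5 g15, 2026-08-29; memo `Cruxes/…/Lines/onelevel-nearmult-probe.md` §4–§7.  A TYPING AID for the successor lead's
memo L21 — NOT tree vocabulary, NOT registered, proves nothing about K1L_D; AD is not proved; rung F-D1.A0.)

Distortion convention (LESSON D28-8′, line 1): `Torus.Visc4.conj M 𝔸 i c j e = Σ_{a,b} M c a * 𝔸 i a j b * M e b` is a DERIVATIVE-index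
conjugation; the class variable is `v = u ∘ X` (components not rotated), `G = (∇X)⁻¹`, and `Torus.distort G v` enters only the constraint.

* `FullBound 𝔹 h` — the full bilinear bound `|𝔹(ξ,η)| ≤ h‖ξ‖‖η‖` on ALL `3×3` matrices (Frobenius), the quantity `hi_f` of the memo §2/§4
  that `Torus.NearIso`/`Torus.OddSmall` (transverse symbol only) do not control (GAP G1).
* `dispJac D y` — the Jacobian matrix `(∂_c X_a)(y)` of the torus self-map `X = id + proj ∘ D` (entry `(a,c)`), the shape of
  `LagrangianStep.frameJac` (`E.flowDeriv = 1 + D(lift disp)`) and of `Torus.HasWeakPartialDeriv.comp_add_proj` (`LagrangianLatticeCarrierFrameChainRule`).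
* `IsFrameModulation θ Tw nC G` — CLASS OF RECORD (D28-8′ (3)): an `IsModulation` that IS the inverse Jacobian of a smooth, measure-preserving,
  two-sided-invertible displacement flow `X_t = id + proj ∘ D t` with inverse `id + proj ∘ Dinv t`: `G t y * dispJac (D t) y = 1`.  Upstream the only
  instance we own, `frameG E m … = (frameJac …)⁻¹` with `D = E.disp m t w`, `Dinv = E.disp m w t`, has every conjunct from `E.Regular`
  (`measurePreserving_X`, `X_X_symm`, smoothness of `disp`).  Null Lagrangians are invisible in this class (`∫ N(∇v·G) dy = ∫ N(∇u) dx = 0`).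
* `HasRate Tw ρr G` — the optional pointwise rate conjunct (R-d); NOT load-bearing for (M_θ)′ by the toy of memo §7 (carry it only if L21 wants it).
* `NearMultGF … hiF … κ` — (M_θ)′: `NearMultG` with `IsModulation ↦ IsFrameModulation` and the two `FullBound` binders added; `nearMultGF_of_nearMultG`
  records that it is a WEAKENING of the typed (M_θ) (so p712075-style assemblies re-thread by monotonicity once their other inputs are re-typed alike).
-/

set_option linter.dupNamespace false

noncomputable section

namespace Summit.AnomalousDissipation.AnomalousDissipation.Cruxes.LagrangianRenormalisationStep.FrameClassSketch

open Literature.Analysis Literature.Analysis.FluidPDE Literature.Analysis.FunctionSpaces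
open MeasureTheory Set
open scoped InnerProductSpace
open Summit.AnomalousDissipation.AnomalousDissipation.Theorems.SolenoidalFractalHomogenisation.LagrangianStep
open Summit.AnomalousDissipation.AnomalousDissipation.Theorems.SolenoidalFractalHomogenisation.LagrangianStep.CellClauseMod
open Summit.AnomalousDissipation.AnomalousDissipation.Theorems.SolenoidalFractalHomogenisation.LagrangianStep.VmodFlat
open Summit.AnomalousDissipation.AnomalousDissipation.Theorems.SolenoidalFractalHomogenisation.LagrangianStep.VmodDist

/-- **(T-a) full bilinear bound** of a 4-tensor on all `3×3` matrices: `|Σ 𝔹 i a j b ξ i a η j b| ≤ h·‖ξ‖_F·‖η‖_F`. -/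
def FullBound (𝔹 : Torus.Visc4 (Fin 3)) (h : ℝ) : Prop :=
  ∀ ξ η : Matrix (Fin 3) (Fin 3) ℝ,
    |∑ i, ∑ a, ∑ j, ∑ b, 𝔹 i a j b * ξ i a * η j b| ≤
      h * Real.sqrt (∑ i, ∑ a, ξ i a ^ 2) * Real.sqrt (∑ j, ∑ b, η j b ^ 2)

/-- The Jacobian matrix `(∂_c X_a)(y)` (entry `(a, c)`) of the torus self-map `X y = y + proj (D y)`. -/
def dispJac (D : UnitAddTorus (Fin 3) → EuclideanSpace ℝ (Fin 3)) (y : UnitAddTorus (Fin 3)) : Matrix (Fin 3) (Fin 3) ℝ :=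
  Matrix.of fun a c => (EuclideanSpace.single c (1 : ℝ)) a + (Torus.partialDeriv c D y) a

/-- **(T-b) FRAME modulation** (class of record, D28-8′): a modulation datum that is the inverse Jacobian of a smooth measure-preserving
invertible displacement flow of the torus, `G t = (D X_t)⁻¹`, `X_t = id + proj ∘ D t`, `X_t⁻¹ = id + proj ∘ Dinv t`. -/
structure IsFrameModulation (θ Tw nC : ℝ) (G : ℝ → UnitAddTorus (Fin 3) → Matrix (Fin 3) (Fin 3) ℝ) : Prop
    extends IsModulation θ Tw nC G where
  frame : ∃ D Dinv : ℝ → UnitAddTorus (Fin 3) → EuclideanSpace ℝ (Fin 3),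
    (∀ t ∈ Icc 0 Tw, Torus.IsSmooth (D t)) ∧ (∀ t ∈ Icc 0 Tw, Torus.IsSmooth (Dinv t)) ∧
    (∀ t ∈ Icc 0 Tw, MeasurePreserving (fun y => y + Torus.proj (D t y)) volume volume) ∧
    (∀ t ∈ Icc 0 Tw, ∀ y, (y + Torus.proj (D t y)) + Torus.proj (Dinv t (y + Torus.proj (D t y))) = y) ∧
    (∀ t ∈ Icc 0 Tw, ∀ x, (x + Torus.proj (Dinv t x)) + Torus.proj (D t (x + Torus.proj (Dinv t x))) = x) ∧
    (∀ t ∈ Icc 0 Tw, ∀ y, G t y * dispJac (D t) y = 1)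

/-- The optional pointwise RATE conjunct (R-d): `|G t₂ − G t₁| ≤ ρr·|t₂ − t₁|` entrywise on the window. -/
def HasRate (Tw ρr : ℝ) (G : ℝ → UnitAddTorus (Fin 3) → Matrix (Fin 3) (Fin 3) ℝ) : Prop :=
  ∀ y i j, ∀ t₁ ∈ Icc 0 Tw, ∀ t₂ ∈ Icc 0 Tw, |G t₂ y i j - G t₁ y i j| ≤ ρr * |t₂ - t₁|

/-- **(M_θ)′ `NearMultGF`** — `NearMultG` re-typed over FRAME modulations with FULL-FORM tensor bounds `hiF` on `ν⁻¹𝔸` and on the renormalised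
tensor (memo §5 (T-a)+(T-b)); everything else verbatim. -/
def NearMultGF (c : ℝ) (Φ : ℝ → Torus.Visc4 (Fin 3) → Torus.Visc4 (Fin 3)) (lo hi hiF Λ β ν₀ K θ₁ ϱ₁ κ : ℝ) : Prop :=
  ∀ ν : ℝ, ν ∈ Set.Ioo 0 ν₀ → ∀ n : ℕ, (⌈K / ν⌉₊ : ℝ) ≤ n → ∀ 𝔸 : Torus.Visc4 (Fin 3),
    Torus.OddSmall 𝔸 (ν * β) → (∃ lam ∈ Set.Icc (1:ℝ) Λ, Torus.NearIso 𝔸 (ν * (lo / lam)) (ν * (hi * lam))) →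
    Torus.OddSmall (Φ ν ((1 / ν) • 𝔸)) β → (∃ lam ∈ Set.Icc (1:ℝ) Λ, Torus.NearIso (Φ ν ((1 / ν) • 𝔸)) (lo / lam) (hi * lam)) →
    FullBound ((1 / ν) • 𝔸) hiF → FullBound (Φ ν ((1 / ν) • 𝔸)) hiF →
    ∀ θ ∈ Set.Icc 0 θ₁, ∀ nC : ℝ, 0 ≤ nC → nC ≤ ϱ₁ * n → ∀ Tw > (0:ℝ),
    ∀ G : ℝ → UnitAddTorus (Fin 3) → Matrix (Fin 3) (Fin 3) ℝ, IsFrameModulation θ Tw nC G →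
    ∀ T : ℝ → ℝ → (V2 →L[ℝ] V2),
      IsDistortedPropagator Tw ((1 / (n:ℝ) ^ 2) • (𝔸 + (c / ν) • Φ ν ((1 / ν) • 𝔸))) (fun _ _ => 0) G T →
    ∀ t : ℝ, 0 < t → t ≤ Tw →
      (∀ xs xf : V2, IsSlow n xs → IsFast n xf →
        |⟪T 0 t xs, T 0 t xf⟫_ℝ| ≤ κ * Real.sqrt (lossFwd (T 0 t) xs) * Real.sqrt (lossFwd (T 0 t) xf)) ∧
      (∀ ζs ζf : V2, IsSlow n ζs → IsFast n ζf →
        |⟪ContinuousLinearMap.adjoint (T 0 t) ζs, ContinuousLinearMap.adjoint (T 0 t) ζf⟫_ℝ|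
          ≤ κ * Real.sqrt (lossAdj (T 0 t) ζs) * Real.sqrt (lossAdj (T 0 t) ζf))

/-- (M_θ)′ is a WEAKENING of the typed (M_θ): fewer modulations, more tensor hypotheses. -/
theorem nearMultGF_of_nearMultG {c : ℝ} {Φ : ℝ → Torus.Visc4 (Fin 3) → Torus.Visc4 (Fin 3)} {lo hi hiF Λ β ν₀ K θ₁ ϱ₁ κ : ℝ}
    (h : NearMultG c Φ lo hi Λ β ν₀ K θ₁ ϱ₁ κ) : NearMultGF c Φ lo hi hiF Λ β ν₀ K θ₁ ϱ₁ κ := by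
  intro ν hν n hn 𝔸 h1 h2 h3 h4 _ _ θ hθ nC hnC hnC' Tw hTw G hG T hT t ht htw
  exact h ν hν n hn 𝔸 h1 h2 h3 h4 θ hθ nC hnC hnC' Tw hTw G hG.toIsModulation T hT t ht htw

/-- Sanity: the identity modulation with the zero displacement is a frame datum for `dispJac` (`dispJac 0 y = 1`). -/
theorem dispJac_zero (y : UnitAddTorus (Fin 3)) : dispJac (fun _ => 0) y = 1 := by
  ext a c
  simp only [dispJac, Matrix.of_apply]
  have h0 : Torus.partialDeriv c (fun _ : UnitAddTorus (Fin 3) => (0 : EuclideanSpace ℝ (Fin 3))) y = 0 := by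
    simp [Torus.partialDeriv, Torus.lineDeriv]
  rw [h0]
  simp [Matrix.one_apply]

end Summit.AnomalousDissipation.AnomalousDissipation.Cruxes.LagrangianRenormalisationStep.FrameClassSketch

end
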